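import Mathlib
import Summits.ValiantsHypothesis.ValiantsHypothesis.Theses.ElementaryWordLength

/-!
# Crux idea `coset-minrank-middle-cut` — first-lemma sketch (crux WordLengthQP, stmt-ValiantsHypothesis-6623)

Nisan's method applied to the word's CANONICAL noncommutative lift, read back commutatively:
a word of length `L` for `E₁₃(per_n)` gives, for EVERY cut `k ≤ n`, a decomposition
`per_n = Σ_{i < 3(L+1)} gᵢ·hᵢ` with `gᵢ` homogeneous of degree `k` and `hᵢ` of degree `n - k`
(states of the width-3 program = (time, register); prefix/suffix polynomials, homogeneous parts).
Hence the single-cut statement `MidCutHard` (product rank of `per_n` at the middle cut is not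
quasi-polynomially bounded) implies the crux `WordLengthQP` with NO conversion loss.

Everything here is a STATEMENT (sorried where marked); the definitions elaborate over Mathlib +
`perPoly` + the route's decl `WordLengthQP`.
-/

namespace Summit.ValiantsHypothesis.ValiantsHypothesis.Cruxes.WordLengthQP.CosetMinrank

open scoped BigOperators
open Literature.Computability.AlgebraicComplexity
open Summit.ValiantsHypothesis.ValiantsHypothesis.Theses.ElementaryWordLength

/-- The crux's word predicate, named: `E₁₃(per_n)` has an affine elementary word of length `≤ L`. -/
def HasWord (n L : ℕ) : Prop :=
  ∃ w : List (Fin 3 × Fin 3 × ℂ × Option (Fin n × Fin n)), w.length ≤ L ∧ (∀ l ∈ w, l.1 ≠ l.2.1) ∧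
    (w.map (fun l => Matrix.transvection l.1 l.2.1
      (MvPolynomial.C l.2.2.1 * l.2.2.2.elim 1 MvPolynomial.X))).prod =
      Matrix.transvection (0 : Fin 3) 2 (perPoly (Fin n) ℂ)

/-- Bidegree-`(k, n-k)` PRODUCT RANK of the permanent is at most `r`:
`per_n = Σ_{i<r} gᵢ hᵢ` with `gᵢ ∈ S_k`, `hᵢ ∈ S_{n-k}` (forms in the `n²` entries). -/
def HasProdDecomp (n k r : ℕ) : Prop :=
  ∃ g h : Fin r → MvPolynomial (Fin n × Fin n) ℂ,
    (∀ i, (g i).IsHomogeneous k) ∧ (∀ i, (h i).IsHomogeneous (n - k)) ∧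
    ∑ i, g i * h i = perPoly (Fin n) ℂ

/-- Same for the determinant (calibration: this one is SMALL, `r ≤ n²`, Mahajan–Vinay / CKV24). -/
def HasProdDecompDet (n k r : ℕ) : Prop :=
  ∃ g h : Fin r → MvPolynomial (Fin n × Fin n) ℂ,
    (∀ i, (g i).IsHomogeneous k) ∧ (∀ i, (h i).IsHomogeneous (n - k)) ∧
    ∑ i, g i * h i = (Matrix.of fun i j : Fin n => (MvPolynomial.X (i, j) : MvPolynomial (Fin n × Fin n) ℂ)).det

/-- The transfer target `C⁺` (strictly stronger than the crux, NOT known to be equivalent to it):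
the middle-cut product rank of `per_n` is not quasi-polynomially bounded. -/
def MidCutHard : Prop :=
  ∀ c : ℕ, ∃ n : ℕ, ∀ r ≤ 2 ^ ((Nat.log 2 n + c) ^ c), ¬ HasProdDecomp n (n / 2) r

/-- Uniform-in-`k` version (any cut suffices for the transfer). -/
def SomeCutHard : Prop :=
  ∀ c : ℕ, ∃ n : ℕ, ∃ k ≤ n, ∀ r ≤ 2 ^ ((Nat.log 2 n + c) ^ c), ¬ HasProdDecomp n k r

/-- FIRST LEMMA (the loss-free transfer, provable now; size M): a word of length `≤ L` for
`E₁₃(per_n)` yields a product decomposition with `≤ L + 1` terms at EVERY cut `k ≤ n`.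
Proof sketch (edge cut of the word's canonical ordered expansion): with `u⁽⁰⁾ = e₁ᵀ`,
`u⁽ᵗ⁾ = u⁽ᵗ⁻¹⁾·Eₜ` and `M⁽ᵗ⁾ = E_{t+1}⋯E_L`, every monomial path of the degree-`n` part of
`u⁽ᴸ⁾₃ = per_n` raises its degree from `k-1` to `k` at a unique VARIABLE letter `t`, whence
`per_n = Σ_{t variable} (λₜ·x_{vₜ}·(u⁽ᵗ⁻¹⁾_{iₜ})_{k-1}) · ((M⁽ᵗ⁾)_{jₜ 3})_{n-k}` — at most `L` products of
homogeneous forms of degrees `k` and `n-k` (one spare term covers `k = 0`). This is Nisan's prefix/suffix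
cut of the word read as a width-3 noncommutative ABP, pushed to the commutative quotient. -/
theorem prodDecomp_of_word (n L : ℕ) (hw : HasWord n L) : ∀ k ≤ n, HasProdDecomp n k (L + 1) := by
  sorry

/-- Consequence: `C⁺ → crux`, by `prodDecomp_of_word` and `2^((log n + c)^c) + 1 ≤ 2^((log n + c + 1)^(c+1))`. -/
theorem wordLengthQP_of_midCutHard (h : MidCutHard) : WordLengthQP := by
  sorry

theorem wordLengthQP_of_someCutHard (h : SomeCutHard) : WordLengthQP := by
  sorry

/-- CALIBRATION 1 (provable now from CKV24 Prop. "det_n has an ABP of width n² and n+1 layers",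
or Mahajan–Vinay clow sequences): the determinant is CHEAP at every cut. Any argument for
`MidCutHard` must therefore use something that fails for `det` — it cannot be support counting. -/
theorem det_prodDecomp_small (n k : ℕ) (hk : k ≤ n) (hn : 1 ≤ n) : HasProdDecompDet n k (n ^ 2) := by
  sorry

/-- A decomposition is JUNK-FREE (torus-homogeneous) when every `gᵢ` is supported on partial
permutation monomials of one fixed (row set, column set) of size `k` and `hᵢ` on the complementary
ones; then no non-permutation monomial ever appears in `gᵢ hᵢ`. -/
def IsJunkFree {n : ℕ} (g h : MvPolynomial (Fin n × Fin n) ℂ) : Prop :=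
  ∃ (R C : Finset (Fin n)), (∀ m ∈ g.support, ∀ e ∈ m.support, e.1 ∈ R ∧ e.2 ∈ C) ∧
    (∀ m ∈ h.support, ∀ e ∈ m.support, e.1 ∉ R ∧ e.2 ∉ C)

/-- CALIBRATION 2 (provable now, three lines of counting: a junk-free product covers at most
`k!(n-k)!` of the `n!` permutation monomials): junk-free (= torus-equivariant = monotone-type)
decompositions of `per_n` need EXACTLY `n.choose k` terms — Laplace is optimal among them, for `per`
AND for `det`. So the whole content of `MidCutHard` is: signed junk (clow-type cancellation) cannot buy
`per` the exponential savings it buys `det`. -/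
theorem junkFree_prodRank_ge (n k r : ℕ) (hk : k ≤ n)
    (g h : Fin r → MvPolynomial (Fin n × Fin n) ℂ)
    (hjf : ∀ i, IsJunkFree (g i) (h i))
    (hsum : ∑ i, g i * h i = perPoly (Fin n) ℂ) : n.choose k ≤ r := by
  sorry

end Summit.ValiantsHypothesis.ValiantsHypothesis.Cruxes.WordLengthQP.CosetMinrank
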